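import Literature.Analysis.Complex.UnitDiscHyperbolicMeasure               -- ★ (H1) this seat: `discMoebius`, `discHyperbolicMeasure`, invariance, composition law
import Literature.MeasureTheory.Group.InvariantOrbitMeasureUniqueness      -- ★ `exists_eq_smul_of_measure_compl_orbit_eq_zero` (uniqueness of the invariant measure on one orbit)
import Literature.NumberTheory.Automorphic.UnitaryGroupAutomorphicRep       -- ★ `unitaryGroupOfForm`, `mem_unitaryGroupOfForm_iff`
import Literature.NumberTheory.Automorphic.ArchLocalRegularOrbitClosed      -- ★ `locallyCompactSpace_complexGL`, `secondCountableTopology_complexGL`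
import Mathlib.Topology.MetricSpace.ProperSpace.Lemmas
import HarnessLib

/-!
# The orbit-chart measure of `U(1,1)`: the push-forward of a Haar measure of `U(1,1)` under `h ↦ h₁₀ ∕ h₀₀` is a multiple of the hyperbolic measure of the disc
(HAT-BOX (H2a); Helgason, *Groups and Geometric Analysis* (2000), Introduction §4 Thm. 4.2∕(25): `U(1,1) ∕ T ≅ 𝔻` with invariant measure `(1 − |z|²)⁻² dz`; Weil 1965 n° 49
Lemme 22 ∕ Folland Thm. 2.49 for the uniqueness of the invariant measure on one orbit)

Topic `NumberTheory/Automorphic`; namespace `Literature.NumberTheory.Automorphic.UnitaryGroup`.  THEOREMS ONLY (no `def`, no instance, no notation, no axiom, no named fact, no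
`sorry`).  Cell `pub/hodgecm-mathlib`, ENGINE T1 (crux H413 = `stmt-HodgeConjecture-24833`), floor-2 road «(J-nc) in-house: DESCENT + HAT-BOX» (PLAN v8; LEAD T8-31 (1));
author F0P3a-p07 (g7).  SECOND of three HAT-BOX files: (H1) ★ `Analysis/Complex/UnitDiscHyperbolicMeasure` (invariance of `μ_hyp`), (H2a) THIS FILE (the measure identity),
(H2b) `ArchRankOneOrbitChart` (the conjugation formula `h·diag(a,b)·h⁻¹ = b·1 + (a−b)·P(h₁₀∕h₀₀)` and the polar∕`(s,θ)` chart — the head p05 (g10)'s FILE M consumes).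

THE GROUP.  `G₂ := unitaryGroupOfForm (starRingEnd ℂ) (diagonal ![1, −1]) ≤ GL₂(ℂ)` (★ `UnitaryGroupAutomorphicRep`) = `U(1,1) = {h | hᴴ J h = J}`, `J = diag(1, −1)`.
THE CHART.  `π h := M_h 0 = h₁₀ ∕ h₀₀ ∈ 𝔻` (★ `discMoebius`): continuous, `π(gh) = M_g(π h)` (★ `discMoebius_mul`), right-invariant under the diagonal torus, and every `w ∈ 𝔻` is
`π(h_w)`, `h_w = (1 − |w|²)^{−½} !![1, w̄; w, 1] ∈ G₂` (so `G₂` acts TRANSITIVELY on `𝔻` by Möbius maps).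
THE THEOREM.  **`exists_map_chart_eq_smul_discHyperbolicMeasure`**: for every Haar measure `μ` on `G₂` there is `C ≠ 0` in `ℝ≥0` with `π_* μ = C • μ_hyp`; equivalently
(`integral_comp_chart_eq_smul_integral`) `∫_{G₂} F(π h) dμ(h) = C • ∫ F dμ_hyp` for every (`μ_hyp`-a.e. strongly measurable) `F : ℂ → E`.  PROOF: equip the disc `X = ↥(ball 0 1)` (inside the proof, no instance is
declared) with the Möbius action of `G₂`; `π_* μ` and `μ_hyp` (pulled back to `X`) are two `G₂`-invariant Borel measures on `X`, finite on compact sets (for `π_* μ`: the chart is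
PROPER, `isCompact_setOf_norm_chart_le` — entries of `h` and `h⁻¹ = J hᴴ J` are bounded when `|π h| ≤ r < 1`), carried by the single orbit `X`; ★
`exists_eq_smul_of_measure_compl_orbit_eq_zero` (Weil∕Folland uniqueness) makes them proportional.
HONEST LABEL: HC_CM is proved only modulo the printed citations until rung 0 closes; this is textbook harmonic analysis on `SU(1,1)` and pays nothing by itself.

## References
* [Helgason2000] S. Helgason, *Groups and Geometric Analysis* (AMS 2000), Introduction §4 (`D = SU(1,1)∕SO(2)`, the invariant measure `(1 − |z|²)⁻² dz`).
* [Folland1995] G. B. Folland, *A Course in Abstract Harmonic Analysis* (1995), Thm. 2.49 (uniqueness of invariant measures on homogeneous spaces).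
* [Rudin1980] W. Rudin, *Function Theory in the Unit Ball of ℂⁿ* (1980), §2.2 (the automorphisms `φ_a` and the invariant measure, `n = 1`).
-/

set_option autoImplicit false

noncomputable section

open MeasureTheory Measure Set Filter Topology Matrix
open Literature.Analysis.Complex Literature.MeasureTheory.Group
open scoped ENNReal NNReal ComplexConjugate MatrixGroups

namespace Literature.NumberTheory.Automorphic.UnitaryGroup

/-! ## §1 `U(1,1)`: the form identity, the inverse, the row relations -/

section Group

/-- Elements of `G₂ = U(diag(1,−1))(ℂ)` satisfy `hᴴ J h = J` (membership, with `(h.map conj)ᵀ = hᴴ`). [cite: Helgason2000, Introduction §4] -/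
theorem conjTranspose_mul_form_mul_eq (h : unitaryGroupOfForm (starRingEnd ℂ) (Matrix.diagonal ![(1 : ℂ), -1])) :
    ((h : GL (Fin 2) ℂ) : Matrix (Fin 2) (Fin 2) ℂ)ᴴ * Matrix.diagonal ![(1 : ℂ), -1] * ((h : GL (Fin 2) ℂ) : Matrix (Fin 2) (Fin 2) ℂ) =
      Matrix.diagonal ![(1 : ℂ), -1] :=
  h.2

/-- `J² = 1` for `J = diag(1, −1)`. [folklore] -/
private theorem form_mul_form : Matrix.diagonal ![(1 : ℂ), -1] * Matrix.diagonal ![(1 : ℂ), -1] = 1 := by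
  rw [Matrix.diagonal_mul_diagonal, ← Matrix.diagonal_one]
  congr 1
  funext i
  fin_cases i <;> simp

/-- **`h⁻¹ = J hᴴ J`** for `h ∈ U(1,1)`. [cite: Helgason2000, Introduction §4] -/
theorem coe_inv_eq_form_mul_conjTranspose_mul_form (h : unitaryGroupOfForm (starRingEnd ℂ) (Matrix.diagonal ![(1 : ℂ), -1])) :
    (((h⁻¹ : unitaryGroupOfForm (starRingEnd ℂ) (Matrix.diagonal ![(1 : ℂ), -1])) : GL (Fin 2) ℂ) : Matrix (Fin 2) (Fin 2) ℂ) =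
      Matrix.diagonal ![(1 : ℂ), -1] * ((h : GL (Fin 2) ℂ) : Matrix (Fin 2) (Fin 2) ℂ)ᴴ * Matrix.diagonal ![(1 : ℂ), -1] := by
  rw [Subgroup.coe_inv, Matrix.coe_units_inv]
  refine Matrix.inv_eq_left_inv ?_
  have e : ((h : GL (Fin 2) ℂ) : Matrix (Fin 2) (Fin 2) ℂ)ᴴ * (Matrix.diagonal ![(1 : ℂ), -1] * ((h : GL (Fin 2) ℂ) : Matrix (Fin 2) (Fin 2) ℂ)) =
      Matrix.diagonal ![(1 : ℂ), -1] := by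
    simpa only [Matrix.mul_assoc] using conjTranspose_mul_form_mul_eq h
  simp only [Matrix.mul_assoc]
  rw [e, form_mul_form]

/-- **The row relations** `h J hᴴ = J` (from `h · (J hᴴ J) = h h⁻¹ = 1` and `J² = 1`). [cite: Helgason2000, Introduction §4] -/
theorem mul_form_mul_conjTranspose_eq (h : unitaryGroupOfForm (starRingEnd ℂ) (Matrix.diagonal ![(1 : ℂ), -1])) :
    ((h : GL (Fin 2) ℂ) : Matrix (Fin 2) (Fin 2) ℂ) * Matrix.diagonal ![(1 : ℂ), -1] * ((h : GL (Fin 2) ℂ) : Matrix (Fin 2) (Fin 2) ℂ)ᴴ =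
      Matrix.diagonal ![(1 : ℂ), -1] := by
  have h1 : ((h : GL (Fin 2) ℂ) : Matrix (Fin 2) (Fin 2) ℂ) *
      (((h⁻¹ : unitaryGroupOfForm (starRingEnd ℂ) (Matrix.diagonal ![(1 : ℂ), -1])) : GL (Fin 2) ℂ) : Matrix (Fin 2) (Fin 2) ℂ) = 1 := by
    rw [Subgroup.coe_inv, ← Units.val_mul, mul_inv_cancel, Units.val_one]
  rw [coe_inv_eq_form_mul_conjTranspose_mul_form, ← Matrix.mul_assoc, ← Matrix.mul_assoc] at h1
  have h2 := congrArg (· * Matrix.diagonal ![(1 : ℂ), -1]) h1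
  simp only [Matrix.mul_assoc, form_mul_form, Matrix.mul_one, Matrix.one_mul] at h2
  simpa only [Matrix.mul_assoc] using h2

/-- Entry `(i, j)` of the row relations `h J hᴴ = J`: `h_{i0} h̄_{j0} − h_{i1} h̄_{j1} = J i j`. [cite: Helgason2000, Introduction §4] -/
theorem apply_mul_conj_apply_sub (h : unitaryGroupOfForm (starRingEnd ℂ) (Matrix.diagonal ![(1 : ℂ), -1])) (i j : Fin 2) :
    ((h : GL (Fin 2) ℂ) : Matrix (Fin 2) (Fin 2) ℂ) i 0 * conj (((h : GL (Fin 2) ℂ) : Matrix (Fin 2) (Fin 2) ℂ) j 0) -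
        ((h : GL (Fin 2) ℂ) : Matrix (Fin 2) (Fin 2) ℂ) i 1 * conj (((h : GL (Fin 2) ℂ) : Matrix (Fin 2) (Fin 2) ℂ) j 1) =
      Matrix.diagonal ![(1 : ℂ), -1] i j := by
  have e := congrFun (congrFun (mul_form_mul_conjTranspose_eq h) i) j
  rw [Matrix.mul_apply, Fin.sum_univ_two, Matrix.mul_apply, Matrix.mul_apply, Fin.sum_univ_two, Fin.sum_univ_two] at e
  simp only [Matrix.conjTranspose_apply, RCLike.star_def, Matrix.diagonal_apply_eq, Fin.isValue,
    Matrix.diagonal_apply_ne _ (show (0 : Fin 2) ≠ 1 by decide), Matrix.diagonal_apply_ne _ (show (1 : Fin 2) ≠ 0 by decide),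
    Matrix.cons_val_zero, Matrix.cons_val_one, mul_one, mul_zero, add_zero, zero_add, mul_neg] at e
  rw [← e]
  ring

/-- `|h₀₀|² − |h₀₁|² = 1` (row relation `(0,0)`). [cite: Helgason2000, Introduction §4] -/
theorem normSq_apply_00_sub_normSq_apply_01 (h : unitaryGroupOfForm (starRingEnd ℂ) (Matrix.diagonal ![(1 : ℂ), -1])) :
    Complex.normSq (((h : GL (Fin 2) ℂ) : Matrix (Fin 2) (Fin 2) ℂ) 0 0) - Complex.normSq (((h : GL (Fin 2) ℂ) : Matrix (Fin 2) (Fin 2) ℂ) 0 1) = 1 := by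
  have e := congrFun (congrFun (mul_form_mul_conjTranspose_eq h) 0) 0
  simp [Matrix.mul_apply, Fin.sum_univ_two, Matrix.conjTranspose_apply, Matrix.diagonal] at e
  apply Complex.ofReal_injective
  push_cast
  rw [Complex.normSq_eq_conj_mul_self, Complex.normSq_eq_conj_mul_self]
  linear_combination e

/-- `|h₁₁|² − |h₁₀|² = 1` (row relation `(1,1)`). [cite: Helgason2000, Introduction §4] -/
theorem normSq_apply_11_sub_normSq_apply_10 (h : unitaryGroupOfForm (starRingEnd ℂ) (Matrix.diagonal ![(1 : ℂ), -1])) :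
    Complex.normSq (((h : GL (Fin 2) ℂ) : Matrix (Fin 2) (Fin 2) ℂ) 1 1) - Complex.normSq (((h : GL (Fin 2) ℂ) : Matrix (Fin 2) (Fin 2) ℂ) 1 0) = 1 := by
  have e := congrFun (congrFun (mul_form_mul_conjTranspose_eq h) 1) 1
  simp [Matrix.mul_apply, Fin.sum_univ_two, Matrix.conjTranspose_apply, Matrix.diagonal] at e
  apply Complex.ofReal_injective
  push_cast
  rw [Complex.normSq_eq_conj_mul_self, Complex.normSq_eq_conj_mul_self]
  linear_combination -e

end Group

/-! ## §2 The chart `π h = M_h 0 = h₁₀ ∕ h₀₀`: disc-valued, equivariant, surjective, proper -/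

section Chart

/-- `h₀₀ ≠ 0` on `U(1,1)` (`|h₀₀|² = 1 + |h₁₀|²`; ★ `den_ne_zero_of_norm_lt_one` at `w = 0`). [cite: Helgason2000, Introduction §4] -/
theorem apply_00_ne_zero (h : unitaryGroupOfForm (starRingEnd ℂ) (Matrix.diagonal ![(1 : ℂ), -1])) :
    ((h : GL (Fin 2) ℂ) : Matrix (Fin 2) (Fin 2) ℂ) 0 0 ≠ 0 := by
  simpa using den_ne_zero_of_norm_lt_one (conjTranspose_mul_form_mul_eq h) (w := 0) (by simp)

/-- The chart value is `h₁₀ ∕ h₀₀`. [cite: Helgason2000, Introduction §4] -/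
theorem chart_eq_div (h : unitaryGroupOfForm (starRingEnd ℂ) (Matrix.diagonal ![(1 : ℂ), -1])) :
    discMoebius ((h : GL (Fin 2) ℂ) : Matrix (Fin 2) (Fin 2) ℂ) 0 = ((h : GL (Fin 2) ℂ) : Matrix (Fin 2) (Fin 2) ℂ) 1 0 / ((h : GL (Fin 2) ℂ) : Matrix (Fin 2) (Fin 2) ℂ) 0 0 := by
  simp [discMoebius_apply]

/-- **The chart lands in the disc**: `|h₁₀ ∕ h₀₀| < 1`. [cite: Helgason2000, Introduction §4] -/
theorem norm_chart_lt_one (h : unitaryGroupOfForm (starRingEnd ℂ) (Matrix.diagonal ![(1 : ℂ), -1])) :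
    ‖discMoebius ((h : GL (Fin 2) ℂ) : Matrix (Fin 2) (Fin 2) ℂ) 0‖ < 1 :=
  norm_discMoebius_lt_one (conjTranspose_mul_form_mul_eq h) (by simp)

/-- **Equivariance**: `π(gh) = M_g(π h)` (★ `discMoebius_mul` at `w = 0`). [cite: Helgason2000, Introduction §4] -/
theorem chart_mul (g h : unitaryGroupOfForm (starRingEnd ℂ) (Matrix.diagonal ![(1 : ℂ), -1])) :
    discMoebius (((g * h : unitaryGroupOfForm (starRingEnd ℂ) (Matrix.diagonal ![(1 : ℂ), -1])) : GL (Fin 2) ℂ) : Matrix (Fin 2) (Fin 2) ℂ) 0 =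
      discMoebius ((g : GL (Fin 2) ℂ) : Matrix (Fin 2) (Fin 2) ℂ) (discMoebius ((h : GL (Fin 2) ℂ) : Matrix (Fin 2) (Fin 2) ℂ) 0) := by
  rw [Subgroup.coe_mul, Units.val_mul]
  exact discMoebius_mul _ _ (by simpa using apply_00_ne_zero h)

/-- Matrix entries depend continuously on `h ∈ U(1,1)`. [folklore] -/
private theorem continuous_apply_entry (i j : Fin 2) :
    Continuous fun h : unitaryGroupOfForm (starRingEnd ℂ) (Matrix.diagonal ![(1 : ℂ), -1]) => ((h : GL (Fin 2) ℂ) : Matrix (Fin 2) (Fin 2) ℂ) i j :=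
  (Units.continuous_val.comp continuous_subtype_val).matrix_elem i j

/-- The chart is continuous. [cite: Helgason2000, Introduction §4] -/
theorem continuous_chart :
    Continuous fun h : unitaryGroupOfForm (starRingEnd ℂ) (Matrix.diagonal ![(1 : ℂ), -1]) => discMoebius ((h : GL (Fin 2) ℂ) : Matrix (Fin 2) (Fin 2) ℂ) 0 := by
  have hf : (fun h : unitaryGroupOfForm (starRingEnd ℂ) (Matrix.diagonal ![(1 : ℂ), -1]) => discMoebius ((h : GL (Fin 2) ℂ) : Matrix (Fin 2) (Fin 2) ℂ) 0) =
      fun h : unitaryGroupOfForm (starRingEnd ℂ) (Matrix.diagonal ![(1 : ℂ), -1]) =>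
        ((h : GL (Fin 2) ℂ) : Matrix (Fin 2) (Fin 2) ℂ) 1 0 / ((h : GL (Fin 2) ℂ) : Matrix (Fin 2) (Fin 2) ℂ) 0 0 := by
    funext h; exact chart_eq_div h
  rw [hf]
  exact (continuous_apply_entry 1 0).div (continuous_apply_entry 0 0) apply_00_ne_zero

/-- **Transitivity**: every point of the disc is a chart value — for `|w| < 1` the matrix `h_w = (1 − |w|²)^{−1∕2} · !![1, w̄; w, 1]` lies in `U(1,1)` and `π(h_w) = w`
(Helgason's `SU(1,1)`-transitivity on `D`; Rudin's `φ_a`). [cite: Helgason2000, Introduction §4] [cite: Rudin1980, Thm. 2.2.2] -/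
theorem exists_chart_eq {w : ℂ} (hw : ‖w‖ < 1) :
    ∃ h : unitaryGroupOfForm (starRingEnd ℂ) (Matrix.diagonal ![(1 : ℂ), -1]), discMoebius ((h : GL (Fin 2) ℂ) : Matrix (Fin 2) (Fin 2) ℂ) 0 = w := by
  have h1 : 0 < 1 - ‖w‖ ^ 2 := by nlinarith [norm_nonneg w]
  set c : ℝ := (Real.sqrt (1 - ‖w‖ ^ 2))⁻¹ with hc
  have hcpos : 0 < c := inv_pos.mpr (Real.sqrt_pos.mpr h1)
  have hc2 : (c : ℂ) ^ 2 * (1 - (Complex.normSq w : ℂ)) = 1 := by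
    have e : c ^ 2 * (1 - ‖w‖ ^ 2) = 1 := by
      rw [hc, inv_pow, Real.sq_sqrt h1.le, inv_mul_cancel₀ h1.ne']
    rw [Complex.normSq_eq_norm_sq]
    exact_mod_cast e
  rw [Complex.normSq_eq_conj_mul_self] at hc2
  set A : Matrix (Fin 2) (Fin 2) ℂ := (c : ℂ) • !![1, conj w; w, 1] with hA
  have hdet : A.det = 1 := by
    rw [hA, Matrix.det_smul, Matrix.det_fin_two_of, Fintype.card_fin]
    linear_combination hc2
  have hmem : Matrix.GeneralLinearGroup.mkOfDetNeZero A (by rw [hdet]; exact one_ne_zero) ∈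
      unitaryGroupOfForm (starRingEnd ℂ) (Matrix.diagonal ![(1 : ℂ), -1]) := by
    rw [mem_unitaryGroupOfForm_iff, Matrix.GeneralLinearGroup.val_mkOfDetNeZero]
    have hcc : (starRingEnd ℂ) (c : ℂ) = c := Complex.conj_ofReal c
    ext i j
    fin_cases i <;> fin_cases j
    · simp [hA, Matrix.mul_apply, Fin.sum_univ_two, Matrix.diagonal, hcc]
      linear_combination hc2
    · simp [hA, Matrix.mul_apply, Fin.sum_univ_two, Matrix.diagonal, hcc]
      ring
    · simp [hA, Matrix.mul_apply, Fin.sum_univ_two, Matrix.diagonal, hcc]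
      ring
    · simp [hA, Matrix.mul_apply, Fin.sum_univ_two, Matrix.diagonal, hcc]
      linear_combination -hc2
  refine ⟨⟨_, hmem⟩, ?_⟩
  show discMoebius A 0 = w
  rw [discMoebius_apply, hA]
  have hc0 : (c : ℂ) ≠ 0 := Complex.ofReal_ne_zero.mpr hcpos.ne'
  simp [hc0]

/-- `U(diag(1,−1))(ℂ)` is closed in `GL₂(ℂ)` (a level set of the continuous map `g ↦ gᴴ J g`). [cite: Helgason2000, Introduction §4] -/
theorem isClosed_unitaryGroupOfForm_diagonal_one_neg_one :
    IsClosed ((unitaryGroupOfForm (starRingEnd ℂ) (Matrix.diagonal ![(1 : ℂ), -1]) : Subgroup (GL (Fin 2) ℂ)) : Set (GL (Fin 2) ℂ)) := by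
  have h1 : Continuous fun g : GL (Fin 2) ℂ => (g : Matrix (Fin 2) (Fin 2) ℂ) := Units.continuous_val
  exact isClosed_eq (((h1.matrix_map Complex.continuous_conj).matrix_transpose.mul continuous_const).mul h1) continuous_const

/-- Entry bound on `{|π h| ≤ r}`: all entries of `h` have norm `≤ (1 + (1 − r²)⁻¹)^{1∕2}` (from `|h₁₀| ≤ r|h₀₀|`, `|h₀₀|² − |h₁₀|² = 1` and the row relations).
[cite: Helgason2000, Introduction §4] -/
theorem norm_apply_le_of_norm_chart_le {r : ℝ} (hr : r < 1) (h : unitaryGroupOfForm (starRingEnd ℂ) (Matrix.diagonal ![(1 : ℂ), -1]))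
    (hle : ‖discMoebius ((h : GL (Fin 2) ℂ) : Matrix (Fin 2) (Fin 2) ℂ) 0‖ ≤ r) (i j : Fin 2) :
    ‖((h : GL (Fin 2) ℂ) : Matrix (Fin 2) (Fin 2) ℂ) i j‖ ≤ Real.sqrt (1 + (1 - r ^ 2)⁻¹) := by
  have hB : 0 < 1 - r ^ 2 := by nlinarith [(norm_nonneg _).trans hle]
  have h00 := apply_00_ne_zero h
  rw [chart_eq_div, norm_div, div_le_iff₀ (norm_pos_iff.mpr h00)] at hle
  have c0 : Complex.normSq (((h : GL (Fin 2) ℂ) : Matrix (Fin 2) (Fin 2) ℂ) 0 0) - Complex.normSq (((h : GL (Fin 2) ℂ) : Matrix (Fin 2) (Fin 2) ℂ) 1 0) = 1 := by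
    have e := conj_apply_mul_apply_00 (conjTranspose_mul_form_mul_eq h)
    apply Complex.ofReal_injective
    push_cast
    rw [Complex.normSq_eq_conj_mul_self, Complex.normSq_eq_conj_mul_self]
    linear_combination e
  have r0 := normSq_apply_00_sub_normSq_apply_01 h
  have r1 := normSq_apply_11_sub_normSq_apply_10 h
  simp only [Complex.normSq_eq_norm_sq] at c0 r0 r1
  have hsq : ‖((h : GL (Fin 2) ℂ) : Matrix (Fin 2) (Fin 2) ℂ) 1 0‖ ^ 2 ≤ r ^ 2 * ‖((h : GL (Fin 2) ℂ) : Matrix (Fin 2) (Fin 2) ℂ) 0 0‖ ^ 2 := by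
    rw [← mul_pow]
    exact pow_le_pow_left₀ (norm_nonneg _) hle 2
  have b00 : ‖((h : GL (Fin 2) ℂ) : Matrix (Fin 2) (Fin 2) ℂ) 0 0‖ ^ 2 ≤ (1 - r ^ 2)⁻¹ := by
    rw [inv_eq_one_div, le_div_iff₀ hB]
    nlinarith
  have key : ‖((h : GL (Fin 2) ℂ) : Matrix (Fin 2) (Fin 2) ℂ) i j‖ ^ 2 ≤ 1 + (1 - r ^ 2)⁻¹ := by
    have hinv : 0 < (1 - r ^ 2)⁻¹ := inv_pos.mpr hB
    fin_cases i <;> fin_cases j <;> simp only [Fin.zero_eta, Fin.isValue, Fin.mk_one] <;> nlinarith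
  calc ‖((h : GL (Fin 2) ℂ) : Matrix (Fin 2) (Fin 2) ℂ) i j‖ = Real.sqrt (‖((h : GL (Fin 2) ℂ) : Matrix (Fin 2) (Fin 2) ℂ) i j‖ ^ 2) :=
        (Real.sqrt_sq (norm_nonneg _)).symm
    _ ≤ Real.sqrt (1 + (1 - r ^ 2)⁻¹) := Real.sqrt_le_sqrt key

/-- The entries of `h⁻¹ = J hᴴ J` have the norms of the (transposed) entries of `h`. [cite: Helgason2000, Introduction §4] -/
theorem norm_inv_apply_eq (h : unitaryGroupOfForm (starRingEnd ℂ) (Matrix.diagonal ![(1 : ℂ), -1])) (i j : Fin 2) :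
    ‖(((h : GL (Fin 2) ℂ)⁻¹ : GL (Fin 2) ℂ) : Matrix (Fin 2) (Fin 2) ℂ) i j‖ = ‖((h : GL (Fin 2) ℂ) : Matrix (Fin 2) (Fin 2) ℂ) j i‖ := by
  rw [← Subgroup.coe_inv, coe_inv_eq_form_mul_conjTranspose_mul_form]
  fin_cases i <;> fin_cases j <;>
    simp [Matrix.mul_apply, Matrix.diagonal, Matrix.conjTranspose_apply]

/-- **THE CHART IS PROPER**: `{h ∈ U(1,1) | |π h| ≤ r}` is compact for `r < 1` — entries of `h` and `h⁻¹` are bounded there, and `U(1,1)` is closed in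
`GL₂(ℂ) ↪ M₂(ℂ) × M₂(ℂ)ᵐᵒᵖ` (★ pattern of `isCompact_setOf_exists_conj_circleDiagonal_mem`). [cite: Helgason2000, Introduction §4] [cite: Folland1995, Thm. 2.49] -/
theorem isCompact_setOf_norm_chart_le {r : ℝ} (hr : r < 1) :
    IsCompact {h : unitaryGroupOfForm (starRingEnd ℂ) (Matrix.diagonal ![(1 : ℂ), -1]) | ‖discMoebius ((h : GL (Fin 2) ℂ) : Matrix (Fin 2) (Fin 2) ℂ) 0‖ ≤ r} := by
  set R : ℝ := Real.sqrt (1 + (1 - r ^ 2)⁻¹) with hR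
  -- the compact box and the closed embedding `h ↦ (h, h⁻¹)`
  have hBox : IsCompact {A : Matrix (Fin 2) (Fin 2) ℂ | ∀ k i, ‖A k i‖ ≤ R} := by
    have hb : IsCompact ((Set.univ.pi fun (_ : Fin 2) => Set.univ.pi fun (_ : Fin 2) => Metric.closedBall (0 : ℂ) R) : Set (Matrix (Fin 2) (Fin 2) ℂ)) :=
      isCompact_univ_pi fun _ => isCompact_univ_pi fun _ => isCompact_closedBall (0 : ℂ) R
    have hEq : {A : Matrix (Fin 2) (Fin 2) ℂ | ∀ k i, ‖A k i‖ ≤ R} =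
        ((Set.univ.pi fun (_ : Fin 2) => Set.univ.pi fun (_ : Fin 2) => Metric.closedBall (0 : ℂ) R) : Set (Matrix (Fin 2) (Fin 2) ℂ)) := by
      ext A
      refine ⟨fun h k _ i _ => ?_, fun h k i => ?_⟩
      · simpa only [Metric.mem_closedBall, dist_zero_right] using h k i
      · simpa only [Metric.mem_closedBall, dist_zero_right] using h k (Set.mem_univ k) i (Set.mem_univ i)
    rw [hEq]
    exact hb
  have hψ : IsClosedEmbedding fun g : unitaryGroupOfForm (starRingEnd ℂ) (Matrix.diagonal ![(1 : ℂ), -1]) =>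
      ((((g : GL (Fin 2) ℂ) : Matrix (Fin 2) (Fin 2) ℂ)), ((((g : GL (Fin 2) ℂ))⁻¹ : GL (Fin 2) ℂ) : Matrix (Fin 2) (Fin 2) ℂ)) := by
    have h1 : IsClosedEmbedding fun g : unitaryGroupOfForm (starRingEnd ℂ) (Matrix.diagonal ![(1 : ℂ), -1]) => (g : GL (Fin 2) ℂ) :=
      isClosed_unitaryGroupOfForm_diagonal_one_neg_one.isClosedEmbedding_subtypeVal
    have h2 : IsClosedEmbedding (Units.embedProduct (Matrix (Fin 2) (Fin 2) ℂ)) := Units.isClosedEmbedding_embedProduct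
    have h3 := ((Homeomorph.refl (Matrix (Fin 2) (Fin 2) ℂ)).prodCongr (@MulOpposite.opHomeomorph (Matrix (Fin 2) (Fin 2) ℂ) _).symm).isClosedEmbedding
    exact (h3.comp h2).comp h1
  have hB : IsCompact ((fun g : unitaryGroupOfForm (starRingEnd ℂ) (Matrix.diagonal ![(1 : ℂ), -1]) =>
      ((((g : GL (Fin 2) ℂ) : Matrix (Fin 2) (Fin 2) ℂ)), ((((g : GL (Fin 2) ℂ))⁻¹ : GL (Fin 2) ℂ) : Matrix (Fin 2) (Fin 2) ℂ))) ⁻¹'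
      ({A : Matrix (Fin 2) (Fin 2) ℂ | ∀ k i, ‖A k i‖ ≤ R} ×ˢ {A : Matrix (Fin 2) (Fin 2) ℂ | ∀ k i, ‖A k i‖ ≤ R})) :=
    hψ.isCompact_preimage (hBox.prod hBox)
  have hclosed : IsClosed {h : unitaryGroupOfForm (starRingEnd ℂ) (Matrix.diagonal ![(1 : ℂ), -1]) | ‖discMoebius ((h : GL (Fin 2) ℂ) : Matrix (Fin 2) (Fin 2) ℂ) 0‖ ≤ r} :=
    isClosed_le continuous_chart.norm continuous_const
  refine hB.of_isClosed_subset hclosed fun h hh => ?_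
  exact ⟨fun k i => norm_apply_le_of_norm_chart_le hr h hh k i, fun k i => by
    rw [norm_inv_apply_eq]; exact norm_apply_le_of_norm_chart_le hr h hh i k⟩

end Chart

/-! ## §3 THE MEASURE IDENTITY `π_* μ = C • μ_hyp` -/

section MeasureIdentity

variable [MeasurableSpace (unitaryGroupOfForm (starRingEnd ℂ) (Matrix.diagonal ![(1 : ℂ), -1]))] [BorelSpace (unitaryGroupOfForm (starRingEnd ℂ) (Matrix.diagonal ![(1 : ℂ), -1]))]

/-- **HAT-BOX, MEASURE FORM: the push-forward of a Haar measure of `U(1,1)` under the orbit chart `h ↦ h₁₀ ∕ h₀₀` is a NON-ZERO multiple of the hyperbolic measure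
`(1 − |w|²)⁻² dA` of the disc.**  Proof: the disc `X = ↥(ball 0 1)` with the Möbius action of `U(1,1)` (★ `discMoebius_mul`, built inside the proof) is ONE orbit (★
`exists_chart_eq`); `π_* μ` (finite on compacta by properness ★ `isCompact_setOf_norm_chart_le`) and `μ_hyp|_X` (invariant by ★ `map_discMoebius_discHyperbolicMeasure`) are two
invariant Radon measures on it, hence proportional (★ `exists_eq_smul_of_measure_compl_orbit_eq_zero_ne_zero`, Weil 1965 n° 49 ∕ Folland Thm. 2.49).
[cite: Helgason2000, Introduction §4] [cite: Folland1995, Thm. 2.49] -/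
theorem exists_map_chart_eq_smul_discHyperbolicMeasure (μ : Measure (unitaryGroupOfForm (starRingEnd ℂ) (Matrix.diagonal ![(1 : ℂ), -1]))) [μ.IsHaarMeasure] :
    ∃ C : ℝ≥0, C ≠ 0 ∧
      μ.map (fun h : unitaryGroupOfForm (starRingEnd ℂ) (Matrix.diagonal ![(1 : ℂ), -1]) => discMoebius ((h : GL (Fin 2) ℂ) : Matrix (Fin 2) (Fin 2) ℂ) 0) = C • discHyperbolicMeasure := by
  classical
  haveI := locallyCompactSpace_complexGL 2
  haveI := secondCountableTopology_complexGL 2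
  haveI : LocallyCompactSpace (unitaryGroupOfForm (starRingEnd ℂ) (Matrix.diagonal ![(1 : ℂ), -1])) := isClosed_unitaryGroupOfForm_diagonal_one_neg_one.isClosedEmbedding_subtypeVal.locallyCompactSpace
  haveI : SecondCountableTopology (unitaryGroupOfForm (starRingEnd ℂ) (Matrix.diagonal ![(1 : ℂ), -1])) := TopologicalSpace.Subtype.secondCountableTopology _
  -- the denominators never vanish on the disc
  have hden : ∀ (g : unitaryGroupOfForm (starRingEnd ℂ) (Matrix.diagonal ![(1 : ℂ), -1])) (x : Metric.ball (0 : ℂ) 1),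
      ((g : GL (Fin 2) ℂ) : Matrix (Fin 2) (Fin 2) ℂ) 0 0 + ((g : GL (Fin 2) ℂ) : Matrix (Fin 2) (Fin 2) ℂ) 0 1 * (x : ℂ) ≠ 0 := fun g x =>
    den_ne_zero_of_norm_lt_one (conjTranspose_mul_form_mul_eq g) (mem_ball_zero_iff.mp x.2)
  -- the Möbius ACTION of `U(1,1)` on the disc (local structure, no instance is declared)
  letI act : MulAction (unitaryGroupOfForm (starRingEnd ℂ) (Matrix.diagonal ![(1 : ℂ), -1])) (Metric.ball (0 : ℂ) 1) :=
    { smul := fun g x => ⟨discMoebius ((g : GL (Fin 2) ℂ) : Matrix (Fin 2) (Fin 2) ℂ) x,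
        mem_ball_zero_iff.mpr (norm_discMoebius_lt_one (conjTranspose_mul_form_mul_eq g) (mem_ball_zero_iff.mp x.2))⟩
      one_smul := fun x => Subtype.ext (by
        show discMoebius (((1 : unitaryGroupOfForm (starRingEnd ℂ) (Matrix.diagonal ![(1 : ℂ), -1])) : GL (Fin 2) ℂ) : Matrix (Fin 2) (Fin 2) ℂ) x = x
        rw [OneMemClass.coe_one, Units.val_one, discMoebius_one])
      mul_smul := fun g h x => Subtype.ext (by
        show discMoebius (((g * h : unitaryGroupOfForm (starRingEnd ℂ) (Matrix.diagonal ![(1 : ℂ), -1])) : GL (Fin 2) ℂ) : Matrix (Fin 2) (Fin 2) ℂ) x =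
          discMoebius ((g : GL (Fin 2) ℂ) : Matrix (Fin 2) (Fin 2) ℂ) (discMoebius ((h : GL (Fin 2) ℂ) : Matrix (Fin 2) (Fin 2) ℂ) x)
        rw [Subgroup.coe_mul, Units.val_mul]
        exact discMoebius_mul _ _ (hden h x)) }
  have smul_def : ∀ (g : unitaryGroupOfForm (starRingEnd ℂ) (Matrix.diagonal ![(1 : ℂ), -1])) (x : Metric.ball (0 : ℂ) 1),
      ((g • x : Metric.ball (0 : ℂ) 1) : ℂ) = discMoebius ((g : GL (Fin 2) ℂ) : Matrix (Fin 2) (Fin 2) ℂ) x := fun _ _ => rfl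
  haveI : ContinuousSMul (unitaryGroupOfForm (starRingEnd ℂ) (Matrix.diagonal ![(1 : ℂ), -1])) (Metric.ball (0 : ℂ) 1) := ⟨by
    have hc : Continuous fun p : (unitaryGroupOfForm (starRingEnd ℂ) (Matrix.diagonal ![(1 : ℂ), -1])) × Metric.ball (0 : ℂ) 1 =>
        discMoebius ((p.1 : GL (Fin 2) ℂ) : Matrix (Fin 2) (Fin 2) ℂ) (p.2 : ℂ) := by
      simp only [discMoebius_apply]
      refine Continuous.div ?_ ?_ (fun p => hden p.1 p.2)
      · exact ((continuous_apply_entry 1 0).comp continuous_fst).add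
          (((continuous_apply_entry 1 1).comp continuous_fst).mul (continuous_subtype_val.comp continuous_snd))
      · exact ((continuous_apply_entry 0 0).comp continuous_fst).add
          (((continuous_apply_entry 0 1).comp continuous_fst).mul (continuous_subtype_val.comp continuous_snd))
    exact hc.subtype_mk _⟩
  -- base point, orbit map, transitivity
  let x₀ : Metric.ball (0 : ℂ) 1 := ⟨0, by simp⟩
  have horb : ∀ h : unitaryGroupOfForm (starRingEnd ℂ) (Matrix.diagonal ![(1 : ℂ), -1]), ((h • x₀ : Metric.ball (0 : ℂ) 1) : ℂ) = discMoebius ((h : GL (Fin 2) ℂ) : Matrix (Fin 2) (Fin 2) ℂ) 0 := fun _ => rfl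
  have horbit : (MulAction.orbit (unitaryGroupOfForm (starRingEnd ℂ) (Matrix.diagonal ![(1 : ℂ), -1])) x₀)ᶜ = ∅ := by
    rw [Set.compl_empty_iff, Set.eq_univ_iff_forall]
    intro x
    obtain ⟨h, hh⟩ := exists_chart_eq (mem_ball_zero_iff.mp x.2)
    exact MulAction.mem_orbit_iff.mpr ⟨h, Subtype.ext (by rw [horb, hh])⟩
  -- `μ₁ = π_* μ` on the disc
  have hmeas_orb : Measurable fun h : unitaryGroupOfForm (starRingEnd ℂ) (Matrix.diagonal ![(1 : ℂ), -1]) => h • x₀ := (continuous_id.smul continuous_const).measurable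
  obtain ⟨μ₁, hμ₁⟩ : ∃ μ₁ : Measure (Metric.ball (0 : ℂ) 1), μ₁ = μ.map fun h : unitaryGroupOfForm (starRingEnd ℂ) (Matrix.diagonal ![(1 : ℂ), -1]) => h • x₀ := ⟨_, rfl⟩
  haveI : SMulInvariantMeasure (unitaryGroupOfForm (starRingEnd ℂ) (Matrix.diagonal ![(1 : ℂ), -1])) (Metric.ball (0 : ℂ) 1) μ₁ := by
    rw [hμ₁]
    exact smulInvariantMeasure_map μ (fun h : unitaryGroupOfForm (starRingEnd ℂ) (Matrix.diagonal ![(1 : ℂ), -1]) => h • x₀) (fun g h => by rw [smul_eq_mul, mul_smul]) hmeas_orb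
  haveI : IsFiniteMeasureOnCompacts μ₁ := ⟨fun K hK => by
    rw [hμ₁, Measure.map_apply hmeas_orb hK.measurableSet]
    have hKc : IsCompact (Subtype.val '' K) := hK.image continuous_subtype_val
    have hKsub : Subtype.val '' K ⊆ Metric.ball (0 : ℂ) 1 := by rintro _ ⟨x, _, rfl⟩; exact x.2
    obtain ⟨r', hr', hKr'⟩ := exists_pos_lt_subset_ball zero_lt_one hKc.isClosed hKsub
    refine (measure_mono ?_).trans_lt (isCompact_setOf_norm_chart_le hr'.2).measure_lt_top
    intro h hh
    have hmem : ((h • x₀ : Metric.ball (0 : ℂ) 1) : ℂ) ∈ Metric.ball (0 : ℂ) r' := hKr' ⟨_, hh, rfl⟩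
    rw [mem_ball_zero_iff, horb] at hmem
    exact hmem.le⟩
  have hμ₁ne : μ₁ ≠ 0 := by
    intro h0
    have e : μ₁ Set.univ = 0 := by rw [h0]; rfl
    rw [hμ₁, Measure.map_apply hmeas_orb MeasurableSet.univ, Set.preimage_univ] at e
    exact (NeZero.ne (μ Set.univ)) e
  -- `μ₂ = μ_hyp` on the disc
  have hemb : MeasurableEmbedding (Subtype.val : Metric.ball (0 : ℂ) 1 → ℂ) := MeasurableEmbedding.subtype_coe measurableSet_ball
  obtain ⟨μ₂, hμ₂⟩ : ∃ μ₂ : Measure (Metric.ball (0 : ℂ) 1), μ₂ = discHyperbolicMeasure.comap (Subtype.val : Metric.ball (0 : ℂ) 1 → ℂ) := ⟨_, rfl⟩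
  have hμ₂_apply : ∀ s : Set (Metric.ball (0 : ℂ) 1), μ₂ s = discHyperbolicMeasure (Subtype.val '' s) := fun s => by
    rw [hμ₂]; exact hemb.comap_apply _ _
  haveI : SMulInvariantMeasure (unitaryGroupOfForm (starRingEnd ℂ) (Matrix.diagonal ![(1 : ℂ), -1])) (Metric.ball (0 : ℂ) 1) μ₂ := ⟨fun c s hs => by
    rw [hμ₂_apply, hμ₂_apply]
    have hset : Subtype.val '' ((fun x : Metric.ball (0 : ℂ) 1 => c • x) ⁻¹' s) =
        discMoebius ((c : GL (Fin 2) ℂ) : Matrix (Fin 2) (Fin 2) ℂ) ⁻¹' (Subtype.val '' s) ∩ Metric.ball (0 : ℂ) 1 := by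
      ext w
      constructor
      · rintro ⟨x, hx, rfl⟩
        exact ⟨⟨c • x, hx, (smul_def c x).symm ▸ rfl⟩, x.2⟩
      · rintro ⟨⟨y, hy, hyw⟩, hw⟩
        refine ⟨⟨w, hw⟩, ?_, rfl⟩
        have hcx : c • (⟨w, hw⟩ : Metric.ball (0 : ℂ) 1) = y := Subtype.ext (by rw [smul_def]; exact hyw.symm)
        show c • (⟨w, hw⟩ : Metric.ball (0 : ℂ) 1) ∈ s
        rw [hcx]; exact hy
    have hinv : (((c⁻¹ : unitaryGroupOfForm (starRingEnd ℂ) (Matrix.diagonal ![(1 : ℂ), -1])) : GL (Fin 2) ℂ) : Matrix (Fin 2) (Fin 2) ℂ) * ((c : GL (Fin 2) ℂ) : Matrix (Fin 2) (Fin 2) ℂ) = 1 := by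
      rw [Subgroup.coe_inv, ← Units.val_mul, inv_mul_cancel, Units.val_one]
    rw [hset, ← discHyperbolicMeasure_eq_inter, ← Measure.map_apply (measurable_discMoebius _) (hemb.measurableSet_image.mpr hs),
      map_discMoebius_discHyperbolicMeasure (conjTranspose_mul_form_mul_eq c) (conjTranspose_mul_form_mul_eq c⁻¹) hinv]⟩
  haveI : IsFiniteMeasureOnCompacts μ₂ := ⟨fun K hK => by
    rw [hμ₂_apply]
    have hKc : IsCompact (Subtype.val '' K) := hK.image continuous_subtype_val
    have hKsub : Subtype.val '' K ⊆ Metric.ball (0 : ℂ) 1 := by rintro _ ⟨x, _, rfl⟩; exact x.2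
    obtain ⟨r', hr', hKr'⟩ := exists_pos_lt_subset_ball zero_lt_one hKc.isClosed hKsub
    rw [discHyperbolicMeasure_apply hKsub]
    have hb : ∀ w ∈ Subtype.val '' K, ENNReal.ofReal (((1 - ‖w‖ ^ 2)⁻¹) ^ 2) ≤ ENNReal.ofReal (((1 - r' ^ 2)⁻¹) ^ 2) := fun w hw => by
      have hwr : ‖w‖ < r' := mem_ball_zero_iff.mp (hKr' hw)
      have h1 : 0 < 1 - r' ^ 2 := by nlinarith [hr'.1, hr'.2]
      have h2 : 1 - r' ^ 2 ≤ 1 - ‖w‖ ^ 2 := by nlinarith [norm_nonneg w]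
      exact ENNReal.ofReal_le_ofReal (pow_le_pow_left₀ (inv_nonneg.mpr (h1.le.trans h2)) (inv_anti₀ h1 h2) 2)
    calc ∫⁻ w in Subtype.val '' K, ENNReal.ofReal (((1 - ‖w‖ ^ 2)⁻¹) ^ 2)
        ≤ ∫⁻ _ in Subtype.val '' K, ENNReal.ofReal (((1 - r' ^ 2)⁻¹) ^ 2) := setLIntegral_mono measurable_const hb
      _ = ENNReal.ofReal (((1 - r' ^ 2)⁻¹) ^ 2) * volume (Subtype.val '' K) := setLIntegral_const _ _
      _ < ⊤ := ENNReal.mul_lt_top ENNReal.ofReal_lt_top hKc.measure_lt_top⟩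
  have hμ₂ne : μ₂ ≠ 0 := by
    intro h0
    have e : μ₂ Set.univ = 0 := by rw [h0]; rfl
    rw [hμ₂_apply, Set.image_univ, Subtype.range_coe, discHyperbolicMeasure_apply subset_rfl] at e
    have hle : ∫⁻ _ in Metric.ball (0 : ℂ) 1, (1 : ℝ≥0∞) ≤ ∫⁻ w in Metric.ball (0 : ℂ) 1, ENNReal.ofReal (((1 - ‖w‖ ^ 2)⁻¹) ^ 2) :=
      setLIntegral_mono (by fun_prop) fun w hw => by
        have hw' : ‖w‖ < 1 := mem_ball_zero_iff.mp hw
        have h1 : 0 < 1 - ‖w‖ ^ 2 := by nlinarith [norm_nonneg w]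
        have h2 : (1 : ℝ) ≤ (1 - ‖w‖ ^ 2)⁻¹ := (one_le_inv₀ h1).mpr (by nlinarith [norm_nonneg w])
        calc (1 : ℝ≥0∞) = ENNReal.ofReal ((1 : ℝ) ^ 2) := by simp
          _ ≤ ENNReal.ofReal (((1 - ‖w‖ ^ 2)⁻¹) ^ 2) := ENNReal.ofReal_le_ofReal (pow_le_pow_left₀ zero_le_one h2 2)
    rw [e, setLIntegral_const, one_mul, nonpos_iff_eq_zero] at hle
    exact (Metric.measure_ball_pos volume (0 : ℂ) zero_lt_one).ne' hle
  -- uniqueness on the single orbit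
  obtain ⟨C, hC0, hC⟩ := exists_eq_smul_of_measure_compl_orbit_eq_zero_ne_zero (unitaryGroupOfForm (starRingEnd ℂ) (Matrix.diagonal ![(1 : ℂ), -1])) x₀ μ₁ μ₂
    (by rw [horbit, measure_empty]) (by rw [horbit, measure_empty]) hμ₁ne hμ₂ne
  refine ⟨C, hC0, ?_⟩
  have e1 : μ.map (fun h : unitaryGroupOfForm (starRingEnd ℂ) (Matrix.diagonal ![(1 : ℂ), -1]) => discMoebius ((h : GL (Fin 2) ℂ) : Matrix (Fin 2) (Fin 2) ℂ) 0) = μ₁.map Subtype.val := by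
    rw [hμ₁, Measure.map_map measurable_subtype_coe hmeas_orb]
    rfl
  rw [e1, hC, Measure.map_smul, hμ₂, map_comap_subtype_coe measurableSet_ball, discHyperbolicMeasure,
    restrict_withDensity measurableSet_ball, Measure.restrict_restrict measurableSet_ball, Set.inter_self]

/-- **HAT-BOX, INTEGRAL FORM**: if `π_* μ = C • μ_hyp` then `∫_{U(1,1)} F(h₁₀ ∕ h₀₀) dμ(h) = C • ∫ F dμ_hyp` for every `μ_hyp`-a.e. strongly measurable `F : ℂ → E`
(the constant `C` of `exists_map_chart_eq_smul_discHyperbolicMeasure`, obtained ONCE for the measure, serves every `E` and `F`). [cite: Helgason2000, Introduction §4]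
[cite: Folland1995, Thm. 2.49] -/
theorem integral_comp_chart_eq_smul_integral {E : Type*} [NormedAddCommGroup E] [NormedSpace ℝ E] (μ : Measure (unitaryGroupOfForm (starRingEnd ℂ) (Matrix.diagonal ![(1 : ℂ), -1]))) {C : ℝ≥0}
    (hC : μ.map (fun h : unitaryGroupOfForm (starRingEnd ℂ) (Matrix.diagonal ![(1 : ℂ), -1]) => discMoebius ((h : GL (Fin 2) ℂ) : Matrix (Fin 2) (Fin 2) ℂ) 0) = C • discHyperbolicMeasure)
    (F : ℂ → E) (hF : AEStronglyMeasurable F discHyperbolicMeasure) :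
    ∫ h : unitaryGroupOfForm (starRingEnd ℂ) (Matrix.diagonal ![(1 : ℂ), -1]), F (discMoebius ((h : GL (Fin 2) ℂ) : Matrix (Fin 2) (Fin 2) ℂ) 0) ∂μ = (C : ℝ) • ∫ w, F w ∂discHyperbolicMeasure := by
  have hmeas : AEMeasurable (fun h : unitaryGroupOfForm (starRingEnd ℂ) (Matrix.diagonal ![(1 : ℂ), -1]) => discMoebius ((h : GL (Fin 2) ℂ) : Matrix (Fin 2) (Fin 2) ℂ) 0) μ := continuous_chart.measurable.aemeasurable
  have hF' : AEStronglyMeasurable F (μ.map fun h : unitaryGroupOfForm (starRingEnd ℂ) (Matrix.diagonal ![(1 : ℂ), -1]) => discMoebius ((h : GL (Fin 2) ℂ) : Matrix (Fin 2) (Fin 2) ℂ) 0) := by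
    rw [hC]; exact hF.smul_measure C
  rw [← integral_map hmeas hF', hC, integral_smul_nnreal_measure, NNReal.smul_def]

end MeasureIdentity

end Literature.NumberTheory.Automorphic.UnitaryGroup

end
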